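import Mathlib
import HarnessLib
import Literature.Combinatorics.Games.ParityGame
import Literature.Combinatorics.Games.UniversalTrees

/-!
# Bridge: plain-data parity games (`ParityGame.lean`) ↔ the `ParityGame` structure (`UniversalTrees.lean`)

`Literature/Combinatorics/Games/` carries two vocabularies for parity games on a finite vertex type:

* the PLAIN DATA `(o : V → Bool) (p : V → ℕ) (E : V → V → Prop)` of
  `Literature.Combinatorics.Games.ParityGame` (file `ParityGame.lean`; VERTEX priorities in `ℕ`,
  the max-parity condition, plays `play o σ τ v` generated by a pair of strategies with memory,
  `ParityGame.EvenWins o p E v`, and the positional predicate `ParityGame.EvenWinsPositional`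
  inlined by route PneNP/PositionalGames), and
* the STRUCTURE `ParityGame V` of `UniversalTrees.lean` (Czerwiński et al. 2019, §2.1: successor
  finsets, every vertex has a successor, positive EDGE priorities; plays as arbitrary paths
  `ParityGame.IsPlay`, Even's strategies `ParityGame.IsStrategy` with histories oldest-first,
  `ParityGame.EvenWinsFrom G v` = "some legal strategy of Even wins every consistent play"), over
  which the progress-measure facts (`ParityGame.evenWins_iff_progressMeasure`, universal trees)
  are stated.

This file identifies them on dead-end-free arenas: `ParityGame.ofRel o p E hE : ParityGame V` is
the game graph induced by the plain data (successors = `E`-successors, the edge `u → w` gets the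
priority `p u + 2`, positive and of the same parity and relative order as `p u`), and

* `ParityGame.isEvenWin_ofRel_iff` — its parity condition on a play `ρ` is
  `Even ((infinitelyOften ρ).sup p)` (the largest vertex priority seen infinitely often is even;
  `frequently_eq_sup_infinitelyOften`, `eventually_le_sup_infinitelyOften`);
* `ParityGame.evenWinsFrom_ofRel_iff` — **`(ofRel o p E hE).EvenWinsFrom v ↔ EvenWins o p E v`**
  (histories are reversed between the two conventions; Odd's arbitrary moves in a consistent play
  are realised by a legal Odd strategy with memory);
* normalising priorities: adding an even constant to `p` changes neither `EvenWins` nor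
  `EvenWinsPositional` (`evenWins_add_even_iff`, `evenWinsPositional_add_even_iff`), so the
  "positive priorities" / "`[1, d]`" conventions of the sources cost nothing.

All statements here are proved. [folklore]
-/

namespace Literature.Combinatorics.Games

open Filter

open scoped Classical

universe u

variable {V : Type u}

/-! ## Histories: most-recent-first (`playHist`) vs oldest-first (`List.range t |>.map ρ`) -/

/-- The history kept by `play` is the reversed list of the previously visited vertices.
[folklore] -/
theorem playHist_eq_reverse_map_range (o : V → Bool) (σ τ : List V → V → V) (v : V) (t : ℕ) :
    playHist o σ τ v t = ((List.range t).map (play o σ τ v)).reverse := by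
  induction t with
  | zero => simp
  | succ t ih => simp [playHist_succ, ih, List.range_succ]

/-- Hence its length is the number of elapsed steps. [folklore] -/
theorem length_playHist (o : V → Bool) (σ τ : List V → V → V) (v : V) (t : ℕ) :
    (playHist o σ τ v t).length = t := by
  simp [playHist_eq_reverse_map_range]

/-! ## The largest priority seen infinitely often -/

section TopPriority

variable [Fintype V]

/-- The maximum of `p` over the vertices visited infinitely often is attained infinitely often
along the play. [folklore] -/
theorem frequently_eq_sup_infinitelyOften (p : V → ℕ) (ρ : ℕ → V) :
    ∃ᶠ i : ℕ in atTop, p (ρ i) = (infinitelyOften ρ).sup p := by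
  obtain ⟨u, hu, hsup⟩ := Finset.exists_mem_eq_sup (infinitelyOften ρ) (infinitelyOften_nonempty ρ) p
  rw [hsup]
  exact (mem_infinitelyOften.mp hu).mono fun i hi => by rw [hi]

/-- Eventually the play only visits vertices it visits infinitely often. [folklore] -/
theorem eventually_mem_infinitelyOften (ρ : ℕ → V) :
    ∀ᶠ i : ℕ in atTop, ρ i ∈ infinitelyOften ρ := by
  have h : ∀ u ∈ (Finset.univ \ infinitelyOften ρ), ∀ᶠ i : ℕ in atTop, ρ i ≠ u := by
    intro u hu
    rw [Finset.mem_sdiff, mem_infinitelyOften, Filter.not_frequently] at hu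
    exact hu.2
  rw [← Filter.eventually_all_finset] at h
  refine h.mono fun i hi => ?_
  by_contra hni
  exact hi (ρ i) (Finset.mem_sdiff.mpr ⟨Finset.mem_univ _, hni⟩) rfl

/-- Eventually every visited priority is at most the maximum over the vertices visited infinitely
often. [folklore] -/
theorem eventually_le_sup_infinitelyOften (p : V → ℕ) (ρ : ℕ → V) :
    ∀ᶠ i : ℕ in atTop, p (ρ i) ≤ (infinitelyOften ρ).sup p :=
  (eventually_mem_infinitelyOften ρ).mono fun _ hi => Finset.le_sup (f := p) hi

/-- **`(infinitelyOften ρ).sup p` is THE largest priority seen infinitely often:** it is seen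
infinitely often and eventually nothing larger is seen; these two properties determine it.
[folklore] -/
theorem eq_sup_infinitelyOften_iff (p : V → ℕ) (ρ : ℕ → V) (q : ℕ) :
    q = (infinitelyOften ρ).sup p ↔
      (∃ᶠ i : ℕ in atTop, p (ρ i) = q) ∧ ∀ᶠ i : ℕ in atTop, p (ρ i) ≤ q := by
  constructor
  · rintro rfl
    exact ⟨frequently_eq_sup_infinitelyOften p ρ, eventually_le_sup_infinitelyOften p ρ⟩
  · rintro ⟨hfreq, hev⟩
    apply le_antisymm
    · obtain ⟨i, hi, hi'⟩ :=
        (hfreq.and_eventually (eventually_le_sup_infinitelyOften p ρ)).exists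
      rw [← hi]
      exact hi'
    · obtain ⟨i, hi, hi'⟩ := ((frequently_eq_sup_infinitelyOften p ρ).and_eventually hev).exists
      rw [← hi]
      exact hi'

end TopPriority

namespace ParityGame

/-! ## Realising a consistent play by an Odd strategy -/

/-- **An arbitrary consistent play is generated by a legal Odd strategy.** Given Even's strategy
`σ` (plain-data convention) and an `E`-path `ρ` from `v` consistent with it, the Odd strategy
"follow `ρ` while possible, otherwise any legal move" is legal and `play o σ τ v = ρ`. [folklore] -/
theorem exists_odd_strategy_play_eq (o : V → Bool) (E : V → V → Prop) (hE : ∀ u, ∃ w, E u w)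
    {σ : List V → V → V} {ρ : ℕ → V} {v : V} (hρ : ∀ i, E (ρ i) (ρ (i + 1))) (h0 : ρ 0 = v)
    (hcons : ∀ i, o (ρ i) = true → ρ (i + 1) = σ ((List.range i).map ρ).reverse (ρ i)) :
    ∃ τ : List V → V → V, (∀ h u, o u = false → E u (τ h u)) ∧ play o σ τ v = ρ := by
  let τ : List V → V → V := fun h u =>
    if E u (ρ (h.length + 1)) then ρ (h.length + 1) else Classical.choose (hE u)
  have hτ : ∀ h u, o u = false → E u (τ h u) := by
    intro h u _
    simp only [τ]
    split_ifs with h'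
    · exact h'
    · exact Classical.choose_spec (hE u)
  refine ⟨τ, hτ, funext fun t => ?_⟩
  -- all earlier positions agree, by induction
  suffices H : ∀ t, ∀ s ≤ t, play o σ τ v s = ρ s from H t t le_rfl
  intro t
  induction t with
  | zero =>
    intro s hs
    obtain rfl : s = 0 := Nat.le_zero.mp hs
    rw [play_zero, h0]
  | succ t ih =>
    intro s hs
    rcases Nat.lt_or_eq_of_le hs with hlt | rfl
    · exact ih s (Nat.lt_succ_iff.mp hlt)
    · have hhist : playHist o σ τ v t = ((List.range t).map ρ).reverse := by
        rw [playHist_eq_reverse_map_range]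
        congr 1
        exact List.map_congr_left fun s hs' => ih s (List.mem_range.mp hs').le
      have ht : play o σ τ v t = ρ t := ih t le_rfl
      rw [play_succ, ht, hhist]
      cases ho : o (ρ t) with
      | true =>
        rw [if_pos rfl]
        exact (hcons t ho).symm
      | false =>
        rw [if_neg (by decide)]
        simp only [τ, List.length_reverse, List.length_map, List.length_range]
        rw [if_pos (hρ t)]

/-! ## The game graph induced by plain data -/

section OfRel

variable [Fintype V]

/-- **The `ParityGame` structure induced by plain data** `(o, p, E)` on a dead-end-free arena:
successors of `u` are its `E`-successors, the edge `u → w` carries the priority `p u + 2`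
(positive, as `UniversalTrees.lean` requires; same parity and relative order as `p u`), and `o`
is the owner map. [folklore] -/
noncomputable def ofRel (o : V → Bool) (p : V → ℕ) (E : V → V → Prop) (hE : ∀ u, ∃ w, E u w) :
    ParityGame V where
  succ u := Finset.univ.filter fun w => E u w
  succ_nonempty u := by
    obtain ⟨w, hw⟩ := hE u
    exact ⟨w, by simp [hw]⟩
  prio u _ := p u + 2
  prio_pos _ _ _ := Nat.succ_pos _
  isEven := o

variable (o : V → Bool) (p : V → ℕ) (E : V → V → Prop) (hE : ∀ u, ∃ w, E u w)

/-- Successors in `ofRel` are `E`-successors. [folklore] -/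
@[simp] theorem mem_succ_ofRel (u w : V) : w ∈ (ofRel o p E hE).succ u ↔ E u w := by
  simp [ofRel]

/-- Edge priorities in `ofRel`. [folklore] -/
@[simp] theorem prio_ofRel (u w : V) : (ofRel o p E hE).prio u w = p u + 2 := rfl

/-- Owners in `ofRel`. [folklore] -/
@[simp] theorem isEven_ofRel : (ofRel o p E hE).isEven = o := rfl

/-- Plays of `ofRel` are the `E`-paths. [folklore] -/
theorem isPlay_ofRel_iff (ρ : ℕ → V) : (ofRel o p E hE).IsPlay ρ ↔ ∀ i, E (ρ i) (ρ (i + 1)) := by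
  simp [IsPlay]

/-- **The parity condition of `ofRel` is the max-parity condition on vertex priorities:** a play
is won by Even iff the largest vertex priority seen infinitely often is even. [folklore] -/
theorem isEvenWin_ofRel_iff (ρ : ℕ → V) :
    (ofRel o p E hE).IsEvenWin ρ ↔ Even ((infinitelyOften ρ).sup p) := by
  simp only [IsEvenWin, prio_ofRel]
  constructor
  · rintro ⟨q, hq, hfreq, hev⟩
    -- `q = sup + 2`
    have h2q : 2 ≤ q := by
      obtain ⟨i, hi⟩ := hfreq.exists
      omega
    obtain ⟨q', rfl⟩ : ∃ q', q = q' + 2 := ⟨q - 2, by omega⟩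
    have hq' : q' = (infinitelyOften ρ).sup p := by
      rw [eq_sup_infinitelyOften_iff]
      exact ⟨hfreq.mono fun i hi => by omega, hev.mono fun i hi => by omega⟩
    rw [← hq']
    exact (Nat.even_add.mp hq).mpr (by decide)
  · intro heven
    refine ⟨(infinitelyOften ρ).sup p + 2, heven.add (by decide), ?_, ?_⟩
    · exact (frequently_eq_sup_infinitelyOften p ρ).mono fun i hi => by rw [hi]
    · exact (eventually_le_sup_infinitelyOften p ρ).mono fun i hi => by omega

/-- Strategies of Even for `ofRel` (histories oldest-first) are the legal strategies with memory
of the plain-data vocabulary read on reversed histories. [folklore] -/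
theorem isStrategy_ofRel_iff (σ : List V → V → V) :
    (ofRel o p E hE).IsStrategy σ ↔ ∀ h u, o u = true → E u (σ h u) := by
  simp [IsStrategy]

/-- The play generated by `play` is an `E`-path when both strategies are legal. [folklore] -/
theorem isPlay_ofRel_play {σ τ : List V → V → V} (hσ : ∀ h u, o u = true → E u (σ h u))
    (hτ : ∀ h u, o u = false → E u (τ h u)) (v : V) : (ofRel o p E hE).IsPlay (play o σ τ v) := by
  rw [isPlay_ofRel_iff]
  intro i
  rw [play_succ]
  cases ho : o (play o σ τ v i) with
  | true => simpa [ho] using hσ (playHist o σ τ v i) _ ho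
  | false => simpa [ho] using hτ (playHist o σ τ v i) _ ho

/-- The play generated by `play o σ τ v` is consistent (in the sense of `UniversalTrees.lean`,
histories oldest-first) with Even's strategy `fun h u => σ h.reverse u`. [folklore] -/
theorem isConsistent_ofRel_play (σ τ : List V → V → V) (v : V) :
    (ofRel o p E hE).IsConsistent (fun h u => σ h.reverse u) (play o σ τ v) := by
  intro i hi
  rw [isEven_ofRel] at hi
  rw [play_succ, if_pos hi, playHist_eq_reverse_map_range]

/-- **The two notions of "Even wins from `v`" agree** on a dead-end-free finite arena:
`EvenWinsFrom` of the induced `ParityGame` structure (some legal strategy of Even wins every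
consistent play, edge priorities `p u + 2`, `UniversalTrees.lean`) iff `EvenWins o p E v` (some
legal strategy with memory of Even beats every legal strategy with memory of Odd, vertex
priorities, `ParityGame.lean`). [folklore] -/
theorem evenWinsFrom_ofRel_iff (v : V) : (ofRel o p E hE).EvenWinsFrom v ↔ EvenWins o p E v := by
  constructor
  · rintro ⟨σ', hσ', hwin⟩
    rw [isStrategy_ofRel_iff] at hσ'
    refine ⟨fun h u => σ' h.reverse u, fun h u hu => hσ' h.reverse u hu, fun τ hτ => ?_⟩
    rw [← isEvenWin_ofRel_iff o p E hE]
    refine hwin _ (isPlay_ofRel_play o p E hE (fun h u hu => hσ' h.reverse u hu) hτ v)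
      (play_zero _ _ _ _) ?_
    have := isConsistent_ofRel_play o p E hE (fun h u => σ' h.reverse u) τ v
    simpa only [List.reverse_reverse] using this
  · rintro ⟨σ, hσ, hwin⟩
    refine ⟨fun h u => σ h.reverse u, (isStrategy_ofRel_iff o p E hE _).mpr
      fun h u hu => hσ h.reverse u hu, fun ρ hρ h0 hcons => ?_⟩
    rw [isPlay_ofRel_iff] at hρ
    have hcons' : ∀ i, o (ρ i) = true → ρ (i + 1) = σ ((List.range i).map ρ).reverse (ρ i) :=
      fun i hi => hcons i (by simpa using hi)
    obtain ⟨τ, hτ, hplay⟩ := exists_odd_strategy_play_eq o E hE hρ h0 hcons'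
    rw [isEvenWin_ofRel_iff, ← hplay]
    exact hwin τ hτ

end OfRel

/-! ## Normalising priorities -/

/-- `sup` of a translate over a nonempty finset. [folklore] -/
theorem sup_add_const {C : Finset V} (hC : C.Nonempty) (p : V → ℕ) (c : ℕ) :
    C.sup (fun u => p u + c) = C.sup p + c := by
  apply le_antisymm
  · exact Finset.sup_le fun u hu => Nat.add_le_add_right (Finset.le_sup hu) c
  · obtain ⟨u₀, hu₀, h0⟩ := Finset.exists_mem_eq_sup C hC p
    rw [h0]
    exact Finset.le_sup (f := fun u => p u + c) hu₀

variable [Fintype V]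

/-- Shifting all priorities by an even constant does not change positional winning. [folklore] -/
theorem evenWinsPositional_add_even_iff (o : V → Bool) (p : V → ℕ) (E : V → V → Prop) (v : V)
    (c : ℕ) : EvenWinsPositional o (fun u => p u + 2 * c) E v ↔ EvenWinsPositional o p E v := by
  unfold EvenWinsPositional
  refine exists_congr fun σ => and_congr Iff.rfl (forall_congr' fun τ => imp_congr Iff.rfl ?_)
  rw [sup_add_const (lassoCycle_nonempty o σ τ v), Nat.even_add]
  exact ⟨fun h' => h'.mpr (even_two_mul c), fun h' => ⟨fun _ => even_two_mul c, fun _ => h'⟩⟩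

/-- Shifting all priorities by an even constant does not change winning. [folklore] -/
theorem evenWins_add_even_iff (o : V → Bool) (p : V → ℕ) (E : V → V → Prop) (v : V) (c : ℕ) :
    EvenWins o (fun u => p u + 2 * c) E v ↔ EvenWins o p E v := by
  unfold EvenWins
  refine exists_congr fun σ => and_congr Iff.rfl (forall_congr' fun τ => imp_congr Iff.rfl ?_)
  rw [sup_add_const (infinitelyOften_nonempty _), Nat.even_add]
  exact ⟨fun h' => h'.mpr (even_two_mul c), fun h' => ⟨fun _ => even_two_mul c, fun _ => h'⟩⟩

end ParityGame

end Literature.Combinatorics.Games
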